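import Mathlib
import HarnessLib
import Literature.Analysis.FluidPDE.Tao2016AveragedNS.TaylorChainCertificate
import Summits.NavierStokesRegularity.NavierStokesRegularity.Theorems.TaylorModelRungThreeDefs
import Summits.NavierStokesRegularity.NavierStokesRegularity.Theorems.TaylorModelRungThreeReadoutPackage

/-!
# Line `taylor-model` on crux K1b-DR (stmt-NavierStokesRegularity-23954) — the five G-stub STATEMENTS of
# skeleton v4 as tree definitions

Definitions-only file (no theorems, no sorry): the propositions `FlowPackageExists` (G0i), `ChainEnclosureHolds`
(G1), `CrossingReadouts` (G2), `TubeLip` (G3), `LandingC1` (G4), VERBATIM from the registered skeleton v4 of the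
line (`Cruxes/DerivativeEnclosureCertificateR/Lines/taylor-model.lean`, sha16 `a500375dfcc940c7`, line owner
ns-idea-2 g3), over the landed G0 statement module `…TaylorModelRungThreeReadoutPackage` (`IsFlowPackage`,
`ChainEnclosure`, `Crossing`, `tauSel`, `KBlock…`) and `…TaylorModelRungThreeDefs` (`TaylorModelSoundness`), so
that the stub provers state `theorem stub_flow : FlowPackageExists`, `theorem stub_chain : ChainEnclosureHolds`,
… against ONE tree declaration each (namespace `…Theorems.TaylorModelReadout`; `open` it). MODEL-lattice rung
TL-M3 only: nothing here is a statement about the Navier–Stokes equations, and nothing is asserted.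
-/

set_option linter.dupNamespace false

noncomputable section

namespace Summit.NavierStokesRegularity.NavierStokesRegularity.Theorems.TaylorModelReadout

open Set Literature.Analysis.FluidPDE.TaoCascade.TaylorChain

/-- G0i · flow package: S1 instantiated for every valid certificate (window coordinates `Fin (4(Ka+Kb+1))`,
`Q := Qb`, weights `ω j`, bound `bb j`; jets identified with `d.P`, `d.Wv` by recursion uniqueness). -/
def FlowPackageExists : Prop :=
  ∀ cd : CertData, cd.Valid → Summit.NavierStokesRegularity.NavierStokesRegularity.Theorems.TaylorModel.TaylorModelSoundness → ∃ φ : Flow, IsFlowPackage cd φ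

/-- G1 · chain enclosure (Lohner-chain soundness along the certificate). -/
def ChainEnclosureHolds : Prop :=
  ∀ (cd : CertData) (φ : Flow), cd.Valid → IsFlowPackage cd φ → ChainEnclosure cd φ

/-- G2 · crossing time (IVT + transversality in the last sub-step) and the (E1) read-outs of K1b-DR. -/
def CrossingReadouts : Prop :=
  ∀ (cd : CertData) (φ : Flow), cd.Valid → IsFlowPackage cd φ → ChainEnclosure cd φ →
    Crossing cd φ (tauSel cd φ) ∧ KBlockE1 cd φ (tauSel cd φ)

/-- G3 · κ-tube ODE clause and flow-Lipschitz segment derivatives of K1b-DR. -/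
def TubeLip : Prop :=
  ∀ (cd : CertData) (φ : Flow), cd.Valid → IsFlowPackage cd φ → ChainEnclosure cd φ →
    Crossing cd φ (tauSel cd φ) → KBlockTube cd φ (tauSel cd φ) ∧ KBlockLip cd φ (tauSel cd φ)

/-- G4 · base landing and the C¹ landing allowance of K1b-DR (via the module's `landD` read-out clause, v2). -/
def LandingC1 : Prop :=
  ∀ (cd : CertData) (φ : Flow), cd.Valid → IsFlowPackage cd φ → ChainEnclosure cd φ →
    Crossing cd φ (tauSel cd φ) → KBlockLand cd φ (tauSel cd φ)

end Summit.NavierStokesRegularity.NavierStokesRegularity.Theorems.TaylorModelReadout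

end
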